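import Literature.Barriers.FinalStateConjecture.ExtremalHorizonSphereDecay
import HarnessLib

/-!
# Barrier catalogue `FinalStateConjecture`: pointwise control on the extremal horizon spheres from
# sphere integrals — the spherical Sobolev step of Aretakis 2012, §15 (Lemma 15.0.1), and the
# reduction of `Aretakis2012_pointwiseDecay` to `L²(S_τ)` decay
# (`Literature/Barriers/FinalStateConjecture/`, D-0021, D-0014; family `gr`)

The named fact `Aretakis2012_pointwiseDecay` (`ExtremalHorizonAxisymmetricDecay.lean`; Aretakis,
JFA 263 (2012), Thm. 5, second clause, in the consequence form `sup_{S_τ} |ψ| → 0` along the horizon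
spheres `S_τ = {r = M} ∩ {t* = τ}` of extremal Kerr, for axisymmetric solutions) is proved in the
source in two layers (§15): (i) `L²` estimates on the spheres `{r = r₀} ∩ Σ_τ` down to `r₀ = M` from
the energy theorems of the paper (§15.1–§15.2; in this library `Kerr.horizonSphereSq_decay_of_shellEnergy`,
`ExtremalHorizonSphereDecay.lean`, derives the qualitative form on `S_τ` from three energy statements),
and (ii) **Lemma 15.0.1**: `|ψ|² ≤ C ∑_{|k| ≤ 2} ∫_{𝕊²} |S^k ψ|²`, whose proof is the Sobolev inequality
`‖ψ‖²_{L^∞(𝕊²)} ≤ C (‖ψ‖²_{L²(𝕊²)} + ‖Δ̸ψ‖²_{L²(𝕊²)})` on the round sphere followed by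
`|Δ̸ψ|² ≤ C (|Qψ|² + |TTψ|² + |ΦΦψ|²)` (`Q` the Carter operator). **This file proves layer (ii) for
axisymmetric functions, with explicit constants, and the resulting reduction of the named fact**:

* `Kerr.sq_integral_weight_mul_le` — the weighted Cauchy–Schwarz inequality
  `(∫_a^b w u)² ≤ (∫_a^b w)(∫_a^b w u²)` (`w ≥ 0`);
* `Kerr.sq_le_integral_sin_of_hasDerivAt` (**the one-dimensional Sobolev inequality for axisymmetric
  profiles**): if `f` has the continuous derivative `f'` on `[0, π]` and `(sin θ f')' = sin θ · L` on
  `(0, π)` with `L` continuous on `[0, π]`, then `f(θ)² ≤ ∫₀^π sin f² + 2π² ∫₀^π sin L²` for all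
  `θ ∈ [0, π]` (FTC from either pole and Cauchy–Schwarz give `(sin θ f')² ≤ min(1 ∓ cos θ) ∫ sin L²`,
  hence `|f'| ≤ ‖√sin · L‖_{L²}`; mean value inequality; `2 min f² ≤ ∫ sin f²`);
* `Kerr.roundLap M Ψ σ θ φ` — **the round Laplacian `Δ̸` of `Ψ|_{S_σ}` in the angular coordinates
  `(θ, φ*)`**, written as a polynomial in the `2`-jet of `Ψ` at `p_σ(θ, φ)` (`Kerr.horizonPoint`) and the
  frame `Θ, ∂_θΘ, Φ̂, ∂_φΦ̂` of `ExtremalHorizonChargeConservationProofs.lean`, smooth through the poles: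
  `Δ̸Ψ = D²Ψ[Θ,Θ] + dΨ(∂_θΘ) + D²Ψ[Φ̂,Φ̂] + sin θ dΨ(∂_φΦ̂) − M cos θ ∂₃Ψ`; the divergence identities
  `∂_θ(sin θ ΘΨ) = sin θ Δ̸Ψ − (sin θ)⁻¹∂_φ²(Ψ∘p)` (`Kerr.hasDerivAt_thetaFlux_theta_roundLap`) and
  `∂_φ²(Ψ∘p) = sin θ · Kerr.phiPhiTerm` (`Kerr.hasDerivAt_phiDeriv_phi`) identify it with
  `(sin θ)⁻¹∂_θ(sin θ ∂_θ) + (sin θ)⁻² ∂_φ²` off the poles;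
* for **axisymmetric** `Ψ` (`Ψ ∘ R_β = Ψ`, `E4.axialRotation`): `∂_φ(Ψ∘p) = 0`, `phiPhiTerm = 0`,
  `∂_θ(sin θ ΘΨ) = sin θ Δ̸Ψ` off the poles (`Kerr.hasDerivAt_thetaFlux_of_axisymmetric`), and
  `Δ̸Ψ` does not depend on `φ` (`Kerr.sin_mul_roundLap_sq_eq_of_axisymmetric`);
* `Kerr.sq_le_sphereIntegrals_of_axisymmetric` (**Lemma 15.0.1, first display, axisymmetric case, on
  `S_σ`**): `Ψ(p_σ(θ, φ))² ≤ (2π)⁻¹ (∫₀^{2π}∫₀^π sin θ Ψ(p_σ)² + 2π² ∫₀^{2π}∫₀^π sin θ (Δ̸Ψ)²)` for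
  `Ψ ∈ C²` axisymmetric, `θ ∈ [0, π]`;
* `Kerr.horizon_decay_of_sphereDecay`: hence `sup_{S_σ}|Ψ| → 0` as soon as both sphere integrals
  tend to `0`;
* `Kerr.exists_horizonPoint_eq`: every point of `S_τ` is `p_τ(θ, φ)` with `θ ∈ [0, π]` (the axis
  points are the poles);
* `Aretakis2012_pointwiseDecay_of_sphereDecay` (**the reduction**): if for every globally represented
  smooth axisymmetric solution `Φ` of the class of the fact (the hypotheses of
  `Kerr.decay_at_horizonPoint`) the sphere integrals of `Φ²` and of `(Δ̸Φ)²` over `S_τ` tend to `0`,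
  then `Aretakis2012_pointwiseDecay` — a general `ψ` of the class being replaced by its cutoff
  rotation average `ψ₀ = 2πψ` near `{r ≥ M} ∩ {t* ≥ 0}` (`Kerr.rotAverage`,
  `ExtremalHorizonAxisymmetricProjection.lean`).

What remains of the printed proof below this file (not proved here, no named facts introduced,
D-0026): the `L²(S_τ)` decay of `ψ` (layer (i): Thms. 1–3 of the paper feeding (A), (B), (F) of
`Kerr.horizonSphereSq_decay_of_shellEnergy`) and of `Δ̸ψ`, which the source obtains from the same
decay applied to the axisymmetric solutions `Qψ` and `T²ψ` through the Carter operator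
(`Δ̸ψ = Qψ − M² sin² θ · TTψ` on `S_τ`, §5.3 and Lemma 15.0.1; the symmetry operator `Q` is not yet in
the tree).

Only real analysis from Mathlib is used (FTC, Cauchy–Schwarz by the discriminant, the mean value
inequality, symmetry-free chain rules along the explicit curves `θ ↦ p_σ(θ, φ)`, `φ ↦ p_σ(θ, φ)`).

## References

* S. Aretakis, *Decay of axisymmetric solutions of the wave equation on extreme Kerr backgrounds*,
  J. Funct. Anal. 263 (2012) 2770–2831 (arXiv:1110.2006): §3 (`|∇̸ψ|²` "with respect to the standard
  metric" on the unit sphere; the symmetry operators `𝕊₀, 𝕊₁, 𝕊₂ ∋ Q`), Thm. 5 (second clause), §15: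
  Lemma 15.0.1 and its proof (the Sobolev inequality on `𝕊²` and `|Δ̸ψ|² ≤ C(|Qψ|² + |TTψ|² + |ΦΦψ|²)`),
  §15.2.2 (key `Aretakis2012`).
* S. Aretakis, *Horizon instability of extremal black holes*, Adv. Theor. Math. Phys. 19 (2015)
  507–530 (arXiv:1206.6598), §2.2 and §5.2 (the spheres `S_τ`, the frame `(T, Y, Θ, Φ)`)
  (key `Aretakis2015`).
-/

noncomputable section

open Set Filter MeasureTheory intervalIntegral
open scoped Topology ContDiff Manifold

namespace Literature.Barriers.FinalStateConjecture.Kerr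

open Literature.Geometry.Lorentzian

/-! ### A weighted Cauchy–Schwarz inequality and the one-dimensional Sobolev inequality for
axisymmetric profiles on `[0, π]` -/

/-- **Weighted Cauchy–Schwarz inequality** on an interval: for a continuous weight `w ≥ 0` and a
continuous `u` on `[a, b]`, `(∫_a^b w u)² ≤ (∫_a^b w) (∫_a^b w u²)` (the discriminant of the
nonnegative quadratic `t ↦ ∫_a^b w (u − t)²`). [folklore] -/
theorem sq_integral_weight_mul_le {w u : ℝ → ℝ} {a b : ℝ} (hab : a ≤ b)
    (hw : ContinuousOn w (Icc a b)) (hu : ContinuousOn u (Icc a b))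
    (hw0 : ∀ x ∈ Icc a b, 0 ≤ w x) :
    (∫ x in a..b, w x * u x) ^ 2 ≤ (∫ x in a..b, w x) * ∫ x in a..b, w x * u x ^ 2 := by
  have hwi : IntervalIntegrable w volume a b := hw.intervalIntegrable_of_Icc hab
  have hwui : IntervalIntegrable (fun x ↦ w x * u x) volume a b :=
    (hw.mul hu).intervalIntegrable_of_Icc hab
  have hwu2i : IntervalIntegrable (fun x ↦ w x * u x ^ 2) volume a b :=
    (hw.mul (hu.pow 2)).intervalIntegrable_of_Icc hab
  have hq : ∀ t : ℝ, 0 ≤ (∫ x in a..b, w x) * (t * t) + (-2 * ∫ x in a..b, w x * u x) * t +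
      ∫ x in a..b, w x * u x ^ 2 := by
    intro t
    have h1 : IntervalIntegrable (fun x ↦ t ^ 2 * w x) volume a b := hwi.const_mul _
    have h2 : IntervalIntegrable (fun x ↦ 2 * t * (w x * u x)) volume a b := hwui.const_mul _
    have h : ∫ x in a..b, w x * (u x - t) ^ 2 =
        (∫ x in a..b, w x) * (t * t) + (-2 * ∫ x in a..b, w x * u x) * t +
          ∫ x in a..b, w x * u x ^ 2 := by
      have hfun : (fun x ↦ w x * (u x - t) ^ 2) =
          fun x ↦ (t ^ 2 * w x - 2 * t * (w x * u x)) + w x * u x ^ 2 := by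
        funext x; ring
      rw [hfun, intervalIntegral.integral_add (h1.sub h2) hwu2i, intervalIntegral.integral_sub h1 h2,
        intervalIntegral.integral_const_mul, intervalIntegral.integral_const_mul]
      ring
    rw [← h]
    exact intervalIntegral.integral_nonneg hab fun x hx ↦ mul_nonneg (hw0 x hx) (sq_nonneg _)
  have hd := discrim_le_zero hq
  rw [discrim] at hd
  nlinarith [hd]

/-- **One-dimensional Sobolev inequality for axisymmetric profiles on the sphere.** Let `f` be
differentiable on `[0, π]` with continuous derivative `f'`, and suppose that on `(0, π)` the
function `θ ↦ sin θ · f'(θ)` has derivative `sin θ · L(θ)` with `L` continuous on `[0, π]` (for the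
profile `f` of an axisymmetric function on `𝕊²`, `L` is its round Laplacian
`Δ̸f = (sin θ)⁻¹ (sin θ f')'`). Then for every `θ ∈ [0, π]`,
`f(θ)² ≤ ∫₀^π sin θ f² dθ + 2π² ∫₀^π sin θ L² dθ`, i.e.
`‖f‖²_{L^∞(𝕊²)} ≤ (2π)⁻¹ (‖f‖²_{L²(𝕊²)} + 2π² ‖Δ̸f‖²_{L²(𝕊²)})` — the Sobolev inequality
`‖ψ‖²_{L^∞(𝕊²)} ≤ C (‖ψ‖²_{L²(𝕊²)} + ‖Δ̸ψ‖²_{L²(𝕊²)})` of Aretakis, JFA 263 (2012), proof of Lemma 15.0.1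
(first display), for axisymmetric functions, with explicit constants. Proof: by the fundamental
theorem of calculus from either pole and the weighted Cauchy–Schwarz inequality,
`(sin θ f')² ≤ min(1 − cos θ, 1 + cos θ) · D`, `D = ∫₀^π sin L²`, whence `f'² ≤ D` on `(0, π)` and, by
continuity, on `[0, π]`; the mean value inequality gives `|f(θ) − f(θ₀)| ≤ π √D`, and at a minimum
point `θ₀` of `f²`, `2 f(θ₀)² ≤ ∫₀^π sin f²`. [cite: Aretakis2012, Lemma 15.0.1 (proof, first display)] -/
theorem sq_le_integral_sin_of_hasDerivAt {f f' L : ℝ → ℝ}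
    (hf : ∀ θ ∈ Icc 0 Real.pi, HasDerivAt f (f' θ) θ) (hf' : ContinuousOn f' (Icc 0 Real.pi))
    (hg : ∀ θ ∈ Ioo 0 Real.pi,
      HasDerivAt (fun x ↦ Real.sin x * f' x) (Real.sin θ * L θ) θ)
    (hL : ContinuousOn L (Icc 0 Real.pi)) {θ : ℝ} (hθ : θ ∈ Icc 0 Real.pi) :
    f θ ^ 2 ≤ (∫ x in (0 : ℝ)..Real.pi, Real.sin x * f x ^ 2) +
      2 * Real.pi ^ 2 * ∫ x in (0 : ℝ)..Real.pi, Real.sin x * L x ^ 2 := by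
  have hπ := Real.pi_pos
  set D := ∫ x in (0 : ℝ)..Real.pi, Real.sin x * L x ^ 2 with hD
  -- continuity and integrability
  have hfc : ContinuousOn f (Icc 0 Real.pi) := fun x hx ↦ (hf x hx).continuousAt.continuousWithinAt
  have hgc : ContinuousOn (fun x ↦ Real.sin x * f' x) (Icc 0 Real.pi) :=
    Real.continuous_sin.continuousOn.mul hf'
  have hsL : ContinuousOn (fun x ↦ Real.sin x * L x) (Icc 0 Real.pi) :=
    Real.continuous_sin.continuousOn.mul hL
  have hsL2 : ContinuousOn (fun x ↦ Real.sin x * L x ^ 2) (Icc 0 Real.pi) :=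
    Real.continuous_sin.continuousOn.mul (hL.pow 2)
  have hsin0 : ∀ x ∈ Icc 0 Real.pi, 0 ≤ Real.sin x := fun x hx ↦
    Real.sin_nonneg_of_nonneg_of_le_pi hx.1 hx.2
  have hD0 : 0 ≤ D :=
    intervalIntegral.integral_nonneg hπ.le fun x hx ↦ mul_nonneg (hsin0 x hx) (sq_nonneg _)
  -- Step 1: `f'² ≤ D` on the open interval
  have hderiv : ∀ x ∈ Ioo 0 Real.pi, f' x ^ 2 ≤ D := by
    intro x hx
    have hx0 : (0 : ℝ) ≤ x := hx.1.le
    have hxπ : x ≤ Real.pi := hx.2.le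
    have hI1 : Icc 0 x ⊆ Icc 0 Real.pi := Icc_subset_Icc le_rfl hxπ
    have hI2 : Icc x Real.pi ⊆ Icc 0 Real.pi := Icc_subset_Icc hx0 le_rfl
    -- FTC from the two poles
    have hftc1 : ∫ s in (0 : ℝ)..x, Real.sin s * L s = Real.sin x * f' x := by
      have h := intervalIntegral.integral_eq_sub_of_hasDerivAt_of_le hx0 (hgc.mono hI1)
        (fun s hs ↦ hg s ⟨hs.1, hs.2.trans_le hxπ⟩) ((hsL.mono hI1).intervalIntegrable_of_Icc hx0)
      rw [h, Real.sin_zero, zero_mul, sub_zero]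
    have hftc2 : ∫ s in x..Real.pi, Real.sin s * L s = -(Real.sin x * f' x) := by
      have h := intervalIntegral.integral_eq_sub_of_hasDerivAt_of_le hxπ (hgc.mono hI2)
        (fun s hs ↦ hg s ⟨hx.1.trans hs.1, hs.2⟩) ((hsL.mono hI2).intervalIntegrable_of_Icc hxπ)
      rw [h, Real.sin_pi, zero_mul, zero_sub]
    -- Cauchy–Schwarz on `[0, x]` and on `[x, π]`
    have hcs1 := sq_integral_weight_mul_le hx0 (Real.continuous_sin.continuousOn)
      (hL.mono hI1) (fun s hs ↦ hsin0 s (hI1 hs))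
    have hcs2 := sq_integral_weight_mul_le hxπ (Real.continuous_sin.continuousOn)
      (hL.mono hI2) (fun s hs ↦ hsin0 s (hI2 hs))
    rw [hftc1, integral_sin, Real.cos_zero] at hcs1
    rw [hftc2, integral_sin, Real.cos_pi] at hcs2
    -- the two partial integrals of `sin L²` are bounded by `D`
    have hi1 : IntervalIntegrable (fun s ↦ Real.sin s * L s ^ 2) volume 0 x :=
      (hsL2.mono hI1).intervalIntegrable_of_Icc hx0
    have hi2 : IntervalIntegrable (fun s ↦ Real.sin s * L s ^ 2) volume x Real.pi :=
      (hsL2.mono hI2).intervalIntegrable_of_Icc hxπ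
    have hsplit : (∫ s in (0 : ℝ)..x, Real.sin s * L s ^ 2) +
        ∫ s in x..Real.pi, Real.sin s * L s ^ 2 = D :=
      intervalIntegral.integral_add_adjacent_intervals hi1 hi2
    have hp1 : 0 ≤ ∫ s in (0 : ℝ)..x, Real.sin s * L s ^ 2 :=
      intervalIntegral.integral_nonneg hx0 fun s hs ↦ mul_nonneg (hsin0 s (hI1 hs)) (sq_nonneg _)
    have hp2 : 0 ≤ ∫ s in x..Real.pi, Real.sin s * L s ^ 2 :=
      intervalIntegral.integral_nonneg hxπ fun s hs ↦ mul_nonneg (hsin0 s (hI2 hs)) (sq_nonneg _)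
    have hc1 : 0 ≤ 1 - Real.cos x := by linarith [Real.cos_le_one x]
    have hc2 : 0 ≤ 1 + Real.cos x := by linarith [Real.neg_one_le_cos x]
    have key1 : Real.sin x ^ 2 * f' x ^ 2 ≤ (1 - Real.cos x) * D := by
      have h1 : (Real.sin x * f' x) ^ 2 ≤ (1 - Real.cos x) * ∫ s in (0 : ℝ)..x,
          Real.sin s * L s ^ 2 := hcs1
      have h2 : (1 - Real.cos x) * (∫ s in (0 : ℝ)..x, Real.sin s * L s ^ 2) ≤
          (1 - Real.cos x) * D := mul_le_mul_of_nonneg_left (by linarith) hc1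
      nlinarith [h1, h2]
    have key2 : Real.sin x ^ 2 * f' x ^ 2 ≤ (1 + Real.cos x) * D := by
      have h1 : (-(Real.sin x * f' x)) ^ 2 ≤ (Real.cos x - -1) * ∫ s in x..Real.pi,
          Real.sin s * L s ^ 2 := hcs2
      have h2 : (1 + Real.cos x) * (∫ s in x..Real.pi, Real.sin s * L s ^ 2) ≤
          (1 + Real.cos x) * D := mul_le_mul_of_nonneg_left (by linarith) hc2
      nlinarith [h1, h2]
    have hsinpos : 0 < Real.sin x := Real.sin_pos_of_pos_of_lt_pi hx.1 hx.2
    have hsin2 : Real.sin x ^ 2 = (1 - Real.cos x) * (1 + Real.cos x) := by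
      rw [Real.sin_sq]; ring
    have hprod : 0 < (1 - Real.cos x) * (1 + Real.cos x) := by rw [← hsin2]; positivity
    rcases le_or_gt 0 (Real.cos x) with hcx | hcx
    · have h1c : 0 < 1 - Real.cos x := by
        rcases hc1.lt_or_eq with h | h
        · exact h
        · rw [← h, zero_mul] at hprod; exact absurd hprod (lt_irrefl 0)
      have hA : (1 - Real.cos x) * ((1 + Real.cos x) * f' x ^ 2) ≤ (1 - Real.cos x) * D := by
        have := key1; rw [hsin2] at this; linarith
      have hB : (1 + Real.cos x) * f' x ^ 2 ≤ D := le_of_mul_le_mul_left hA h1c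
      nlinarith [hB, hcx, sq_nonneg (f' x)]
    · have h1c : 0 < 1 + Real.cos x := by
        rcases hc2.lt_or_eq with h | h
        · exact h
        · rw [← h, mul_zero] at hprod; exact absurd hprod (lt_irrefl 0)
      have hA : (1 + Real.cos x) * ((1 - Real.cos x) * f' x ^ 2) ≤ (1 + Real.cos x) * D := by
        have := key2; rw [hsin2] at this; linarith
      have hB : (1 - Real.cos x) * f' x ^ 2 ≤ D := le_of_mul_le_mul_left hA h1c
      nlinarith [hB, hcx, sq_nonneg (f' x)]
  -- Step 2: `f'² ≤ D` on the closed interval, by continuity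
  have hderiv' : ∀ x ∈ Icc 0 Real.pi, f' x ^ 2 ≤ D := by
    have hclosed : IsClosed (Icc 0 Real.pi ∩ (fun x ↦ f' x ^ 2) ⁻¹' Iic D) :=
      (hf'.pow 2).preimage_isClosed_of_isClosed isClosed_Icc isClosed_Iic
    have hsub : Ioo 0 Real.pi ⊆ Icc 0 Real.pi ∩ (fun x ↦ f' x ^ 2) ⁻¹' Iic D :=
      fun x hx ↦ ⟨Ioo_subset_Icc_self hx, hderiv x hx⟩
    have hcl := closure_minimal hsub hclosed
    rw [closure_Ioo hπ.ne] at hcl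
    exact fun x hx ↦ (hcl hx).2
  -- Step 3: the mean value inequality on `[0, π]`
  have hbound : ∀ x ∈ Icc 0 Real.pi, ‖f' x‖ ≤ Real.sqrt D := fun x hx ↦ by
    rw [Real.norm_eq_abs]
    exact Real.abs_le_sqrt (hderiv' x hx)
  have hlip : ∀ x ∈ Icc 0 Real.pi, ∀ y ∈ Icc 0 Real.pi, ‖f y - f x‖ ≤ Real.sqrt D * ‖y - x‖ :=
    fun x hx y hy ↦ (convex_Icc 0 Real.pi).norm_image_sub_le_of_norm_hasDerivWithin_le
      (fun z hz ↦ (hf z hz).hasDerivWithinAt) hbound hx hy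
  -- Step 4: a minimum point of `f²`
  obtain ⟨θ₀, hθ₀, hmin⟩ := isCompact_Icc.exists_isMinOn (nonempty_Icc.2 hπ.le) (hfc.pow 2)
  have hmin' : ∀ x ∈ Icc 0 Real.pi, f θ₀ ^ 2 ≤ f x ^ 2 := fun x hx ↦ (isMinOn_iff.mp hmin) x hx
  have hmean : 2 * f θ₀ ^ 2 ≤ ∫ x in (0 : ℝ)..Real.pi, Real.sin x * f x ^ 2 := by
    have h1 : ∫ x in (0 : ℝ)..Real.pi, Real.sin x * f θ₀ ^ 2 = 2 * f θ₀ ^ 2 := by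
      rw [intervalIntegral.integral_mul_const, integral_sin, Real.cos_zero, Real.cos_pi]; ring
    rw [← h1]
    refine intervalIntegral.integral_mono_on hπ.le ?_ ?_ fun x hx ↦ ?_
    · exact (Real.continuous_sin.mul continuous_const).intervalIntegrable _ _
    · exact (Real.continuous_sin.continuousOn.mul (hfc.pow 2)).intervalIntegrable_of_Icc hπ.le
    · exact mul_le_mul_of_nonneg_left (hmin' x hx) (hsin0 x hx)
  -- Step 5: combine
  have hdist : ‖f θ - f θ₀‖ ≤ Real.sqrt D * Real.pi := by
    refine (hlip θ₀ hθ₀ θ hθ).trans (mul_le_mul_of_nonneg_left ?_ (Real.sqrt_nonneg D))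
    rw [Real.norm_eq_abs, abs_le]
    constructor <;> linarith [hθ.1, hθ.2, hθ₀.1, hθ₀.2]
  rw [Real.norm_eq_abs] at hdist
  have hsq : Real.sqrt D ^ 2 = D := Real.sq_sqrt hD0
  have habs : |f θ| ≤ |f θ₀| + Real.sqrt D * Real.pi := by
    have := abs_sub_abs_le_abs_sub (f θ) (f θ₀)
    linarith
  have h0 : 0 ≤ |f θ₀| + Real.sqrt D * Real.pi := by positivity
  have hsq2 : f θ ^ 2 ≤ (|f θ₀| + Real.sqrt D * Real.pi) ^ 2 := by
    rw [← sq_abs (f θ)]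
    exact pow_le_pow_left₀ (abs_nonneg _) habs 2
  have hexp : (|f θ₀| + Real.sqrt D * Real.pi) ^ 2 ≤ 2 * f θ₀ ^ 2 + 2 * Real.pi ^ 2 * D := by
    have h := sq_nonneg (|f θ₀| - Real.sqrt D * Real.pi)
    have h' : |f θ₀| ^ 2 = f θ₀ ^ 2 := sq_abs _
    nlinarith [h, h', hsq]
  linarith [hsq2, hexp, hmean]

/-! ### The round Laplacian of a function on the horizon spheres, in a form smooth through the
poles -/

/-- **The round Laplacian on the horizon spheres.** For `Ψ : E4 → ℝ` and the point
`p = p_σ(θ, φ)` of `S_σ` (`horizonPoint`), with the frame `Θ = ∂_θ p` (`thetaVec`), `∂_θΘ`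
(`dThetaVec`), `Φ̂ = ∂_φ p / sin θ` (`phiHatVec`), `∂_φΦ̂` (`dPhiHatVec`):
`Δ̸Ψ(σ, θ, φ) = D²Ψ(p)[Θ, Θ] + dΨ(p)(∂_θΘ) + D²Ψ(p)[Φ̂, Φ̂] + sin θ · dΨ(p)(∂_φΦ̂) − M cos θ · ∂₃Ψ(p)`.
Off the poles this is the Laplacian of the round unit sphere in the angular coordinates `(θ, φ*)`,
`(sin θ)⁻¹ ∂_θ(sin θ ∂_θ(Ψ ∘ p)) + (sin θ)⁻² ∂_φ²(Ψ ∘ p)` (`hasDerivAt_thetaFlux_theta_roundLap`,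
`hasDerivAt_phiDeriv_phi`: the singular parts of `cot θ ∂_θ` and `(sin θ)⁻² ∂_φ²` combine into the
smooth field `sin θ ∂_φΦ̂` because `Θ = −cos θ ∂_φΦ̂ − M sin θ ∂₃`), i.e. the operator `Δ̸` (norm of
`Δ̸_{𝕊²}` "with respect to the standard metric" on the unit sphere) of Aretakis, JFA 263 (2012), §3 and
proof of Lemma 15.0.1, restricted to the horizon spheres `S_σ ⊆ {r = M}`; the expression is a
polynomial in the `2`-jet of `Ψ` at `p` and in `sin, cos` of the angles, hence continuous through the
poles. [cite: Aretakis2012, Lemma 15.0.1 (proof)] -/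
def roundLap (M : ℝ) (Ψ : E4 → ℝ) (σ θ φ : ℝ) : ℝ :=
  fderiv ℝ (fderiv ℝ Ψ) (horizonPoint M σ θ φ) (thetaVec M θ φ) (thetaVec M θ φ) +
      fderiv ℝ Ψ (horizonPoint M σ θ φ) (dThetaVec M θ φ) +
    (fderiv ℝ (fderiv ℝ Ψ) (horizonPoint M σ θ φ) (phiHatVec M φ) (phiHatVec M φ) +
      Real.sin θ * fderiv ℝ Ψ (horizonPoint M σ θ φ) (dPhiHatVec M φ)) -
    M * Real.cos θ * fderiv ℝ Ψ (horizonPoint M σ θ φ) (E4.basisVector 3)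

/-- The normalised second azimuthal derivative `(sin θ)⁻¹ ∂_φ²(Ψ ∘ p) = sin θ · D²Ψ(p)[Φ̂, Φ̂] + dΨ(p)(∂_φΦ̂)`
(`hasDerivAt_phiDeriv_phi`); it vanishes for axisymmetric `Ψ`. [folklore] -/
def phiPhiTerm (M : ℝ) (Ψ : E4 → ℝ) (σ θ φ : ℝ) : ℝ :=
  Real.sin θ * fderiv ℝ (fderiv ℝ Ψ) (horizonPoint M σ θ φ) (phiHatVec M φ) (phiHatVec M φ) +
    fderiv ℝ Ψ (horizonPoint M σ θ φ) (dPhiHatVec M φ)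

/-- **The polar frame vector through the azimuthal one**: `Θ = −cos θ · ∂_φΦ̂ − M sin θ · ∂₃`.
[folklore] -/
theorem thetaVec_eq_dPhiHatVec (M θ φ : ℝ) :
    thetaVec M θ φ = -Real.cos θ • dPhiHatVec M φ - (M * Real.sin θ) • E4.basisVector 3 := by
  ext i
  fin_cases i <;> simp [thetaVec, dPhiHatVec] <;> ring

/-- **`∂_θ(sin θ · ΘΨ) = sin θ · Δ̸Ψ − (sin θ)⁻¹ ∂_φ²(Ψ ∘ p)`** at every angle, for `Ψ` of class `C²`
at the horizon point: the polar part of the round Laplacian in divergence form. [folklore] -/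
theorem hasDerivAt_thetaFlux_theta_roundLap {M : ℝ} {Ψ : E4 → ℝ} {σ θ φ : ℝ}
    (hΨ : ContDiffAt ℝ 2 Ψ (horizonPoint M σ θ φ)) :
    HasDerivAt (fun θ' ↦ thetaFlux M Ψ σ θ' φ)
      (Real.sin θ * roundLap M Ψ σ θ φ - phiPhiTerm M Ψ σ θ φ) θ := by
  refine (hasDerivAt_thetaFlux_theta hΨ).congr_deriv ?_
  have hlin : fderiv ℝ Ψ (horizonPoint M σ θ φ) (thetaVec M θ φ) =
      -Real.cos θ * fderiv ℝ Ψ (horizonPoint M σ θ φ) (dPhiHatVec M φ) -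
        M * Real.sin θ * fderiv ℝ Ψ (horizonPoint M σ θ φ) (E4.basisVector 3) := by
    rw [thetaVec_eq_dPhiHatVec, map_sub, map_smul, map_smul, smul_eq_mul, smul_eq_mul]
  simp only [roundLap, phiPhiTerm]
  rw [hlin]
  linear_combination (-(fderiv ℝ Ψ (horizonPoint M σ θ φ) (dPhiHatVec M φ))) *
    Real.sin_sq_add_cos_sq θ

/-- `∂_φ (Ψ ∘ p) = sin θ · Φ̂Ψ`. [folklore] -/
theorem hasDerivAt_comp_horizonPoint_phi {M : ℝ} {Ψ : E4 → ℝ} {σ θ φ : ℝ}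
    (hΨ : DifferentiableAt ℝ Ψ (horizonPoint M σ θ φ)) :
    HasDerivAt (fun φ' ↦ Ψ (horizonPoint M σ θ φ'))
      (Real.sin θ * fderiv ℝ Ψ (horizonPoint M σ θ φ) (phiHatVec M φ)) φ := by
  have h := hΨ.hasFDerivAt.comp_hasDerivAt φ (hasDerivAt_horizonPoint_phi M σ θ φ)
  refine (h.congr_of_eventuallyEq (Eventually.of_forall fun φ' ↦ rfl)).congr_deriv ?_
  rw [map_smul, smul_eq_mul]

/-- `∂_θ (Ψ ∘ p) = ΘΨ`. [folklore] -/
theorem hasDerivAt_comp_horizonPoint_theta {M : ℝ} {Ψ : E4 → ℝ} {σ θ φ : ℝ}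
    (hΨ : DifferentiableAt ℝ Ψ (horizonPoint M σ θ φ)) :
    HasDerivAt (fun θ' ↦ Ψ (horizonPoint M σ θ' φ))
      (fderiv ℝ Ψ (horizonPoint M σ θ φ) (thetaVec M θ φ)) θ := by
  have h := hΨ.hasFDerivAt.comp_hasDerivAt θ (hasDerivAt_horizonPoint_theta M σ θ φ)
  exact h.congr_of_eventuallyEq (Eventually.of_forall fun θ' ↦ rfl)

/-- **`∂_φ(sin θ · Φ̂Ψ) = sin θ · ((sin θ)⁻¹ ∂_φ²(Ψ ∘ p))`**, i.e. `∂_φ²(Ψ ∘ p) = sin θ · phiPhiTerm`,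
for `Ψ` of class `C²` at the horizon point. [folklore] -/
theorem hasDerivAt_phiDeriv_phi {M : ℝ} {Ψ : E4 → ℝ} {σ θ φ : ℝ}
    (hΨ : ContDiffAt ℝ 2 Ψ (horizonPoint M σ θ φ)) :
    HasDerivAt (fun φ' ↦ Real.sin θ * fderiv ℝ Ψ (horizonPoint M σ θ φ') (phiHatVec M φ'))
      (Real.sin θ * phiPhiTerm M Ψ σ θ φ) φ := by
  set p := horizonPoint M σ θ φ with hp
  have hcurve := hasDerivAt_horizonPoint_phi M σ θ φ
  have hB : HasFDerivAt (fderiv ℝ Ψ) (fderiv ℝ (fderiv ℝ Ψ) p) p :=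
    ((hΨ.fderiv_right (m := 1) le_rfl).differentiableAt one_ne_zero).hasFDerivAt
  have hc : HasDerivAt (fun φ' ↦ fderiv ℝ Ψ (horizonPoint M σ θ φ'))
      (fderiv ℝ (fderiv ℝ Ψ) p (Real.sin θ • phiHatVec M φ)) φ := hB.comp_hasDerivAt φ hcurve
  have h3 := (hc.clm_apply (hasDerivAt_phiHatVec M φ)).const_mul (Real.sin θ)
  refine (h3.congr_of_eventuallyEq (Eventually.of_forall fun φ' ↦ rfl)).congr_deriv ?_
  simp only [phiPhiTerm, map_smul, FunLike.coe_smul, Pi.smul_apply, smul_eq_mul, hp]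

/-! ### Axisymmetric functions on the horizon spheres -/

section Axisymmetric

variable {M : ℝ} {Ψ : E4 → ℝ}

/-- An axisymmetric function takes the same value along each circle of latitude of `S_σ`.
[folklore] -/
theorem apply_horizonPoint_eq_of_axisymmetric (haxi : ∀ β x, Ψ (E4.axialRotation β x) = Ψ x)
    (σ θ φ : ℝ) : Ψ (horizonPoint M σ θ φ) = Ψ (horizonPoint M σ θ 0) := by
  have h := axialRotation_horizonPoint φ M σ θ 0
  rw [zero_add] at h
  rw [← h, haxi]

/-- For an axisymmetric differentiable function, `sin θ · Φ̂Ψ = ∂_φ(Ψ ∘ p) = 0`. [folklore] -/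
theorem sin_mul_fderiv_phiHatVec_eq_zero (hΨ : Differentiable ℝ Ψ)
    (haxi : ∀ β x, Ψ (E4.axialRotation β x) = Ψ x) (σ θ φ : ℝ) :
    Real.sin θ * fderiv ℝ Ψ (horizonPoint M σ θ φ) (phiHatVec M φ) = 0 := by
  have h1 := hasDerivAt_comp_horizonPoint_phi (M := M) (σ := σ) (θ := θ) (φ := φ) (hΨ _)
  have hfun : (fun φ' ↦ Ψ (horizonPoint M σ θ φ')) = fun _ ↦ Ψ (horizonPoint M σ θ 0) :=
    funext fun φ' ↦ apply_horizonPoint_eq_of_axisymmetric haxi σ θ φ'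
  rw [hfun] at h1
  exact h1.unique (hasDerivAt_const φ _)

/-- For an axisymmetric `C²` function, `sin θ · phiPhiTerm = ∂_φ²(Ψ ∘ p) = 0`. [folklore] -/
theorem sin_mul_phiPhiTerm_eq_zero (hΨ : ContDiff ℝ 2 Ψ)
    (haxi : ∀ β x, Ψ (E4.axialRotation β x) = Ψ x) (σ θ φ : ℝ) :
    Real.sin θ * phiPhiTerm M Ψ σ θ φ = 0 := by
  have h1 := hasDerivAt_phiDeriv_phi (M := M) (σ := σ) (θ := θ) (φ := φ) hΨ.contDiffAt
  have hfun : (fun φ' ↦ Real.sin θ * fderiv ℝ Ψ (horizonPoint M σ θ φ') (phiHatVec M φ')) =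
      fun _ ↦ (0 : ℝ) :=
    funext fun φ' ↦ sin_mul_fderiv_phiHatVec_eq_zero (hΨ.differentiable two_ne_zero) haxi σ θ φ'
  rw [hfun] at h1
  simpa using h1.unique (hasDerivAt_const φ (0 : ℝ))

/-- Off the poles, `phiPhiTerm = 0` for an axisymmetric `C²` function. [folklore] -/
theorem phiPhiTerm_eq_zero (hΨ : ContDiff ℝ 2 Ψ) (haxi : ∀ β x, Ψ (E4.axialRotation β x) = Ψ x)
    (σ : ℝ) {θ : ℝ} (hθ : Real.sin θ ≠ 0) (φ : ℝ) : phiPhiTerm M Ψ σ θ φ = 0 := by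
  have h := sin_mul_phiPhiTerm_eq_zero (M := M) hΨ haxi σ θ φ
  rcases mul_eq_zero.mp h with h | h
  · exact absurd h hθ
  · exact h

/-- **`∂_θ(sin θ · ΘΨ) = sin θ · Δ̸Ψ` off the poles, for axisymmetric `C²` functions** — the
divergence form of the round Laplacian on functions of `θ` alone. [cite: Aretakis2012, Lemma 15.0.1 (proof)] -/
theorem hasDerivAt_thetaFlux_of_axisymmetric (hΨ : ContDiff ℝ 2 Ψ)
    (haxi : ∀ β x, Ψ (E4.axialRotation β x) = Ψ x) (σ : ℝ) {θ : ℝ} (hθ : Real.sin θ ≠ 0) (φ : ℝ) :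
    HasDerivAt (fun θ' ↦ thetaFlux M Ψ σ θ' φ) (Real.sin θ * roundLap M Ψ σ θ φ) θ := by
  have h := hasDerivAt_thetaFlux_theta_roundLap (M := M) (σ := σ) (θ := θ) (φ := φ) hΨ.contDiffAt
  rwa [phiPhiTerm_eq_zero hΨ haxi σ hθ φ, sub_zero] at h

/-- The polar flux of an axisymmetric differentiable function does not depend on `φ`. [folklore] -/
theorem thetaFlux_eq_of_axisymmetric (hΨ : Differentiable ℝ Ψ)
    (haxi : ∀ β x, Ψ (E4.axialRotation β x) = Ψ x) (σ θ φ : ℝ) :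
    thetaFlux M Ψ σ θ φ = thetaFlux M Ψ σ θ 0 := by
  have h1 := hasDerivAt_comp_horizonPoint_theta (M := M) (σ := σ) (θ := θ) (φ := φ) (hΨ _)
  have h0 := hasDerivAt_comp_horizonPoint_theta (M := M) (σ := σ) (θ := θ) (φ := 0) (hΨ _)
  have hfun : (fun θ' ↦ Ψ (horizonPoint M σ θ' φ)) = fun θ' ↦ Ψ (horizonPoint M σ θ' 0) :=
    funext fun θ' ↦ apply_horizonPoint_eq_of_axisymmetric haxi σ θ' φ
  rw [hfun] at h1
  simp only [thetaFlux, h1.unique h0]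

/-- **The round Laplacian of an axisymmetric `C²` function does not depend on `φ`** (off the
poles; at the poles the weight `sin θ` vanishes). [folklore] -/
theorem sin_mul_roundLap_sq_eq_of_axisymmetric (hΨ : ContDiff ℝ 2 Ψ)
    (haxi : ∀ β x, Ψ (E4.axialRotation β x) = Ψ x) (σ θ φ : ℝ) :
    Real.sin θ * roundLap M Ψ σ θ φ ^ 2 = Real.sin θ * roundLap M Ψ σ θ 0 ^ 2 := by
  by_cases hθ : Real.sin θ = 0
  · rw [hθ, zero_mul, zero_mul]
  have h1 := hasDerivAt_thetaFlux_of_axisymmetric (M := M) hΨ haxi σ hθ φ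
  have h0 := hasDerivAt_thetaFlux_of_axisymmetric (M := M) hΨ haxi σ hθ 0
  have hfun : (fun θ' ↦ thetaFlux M Ψ σ θ' φ) = fun θ' ↦ thetaFlux M Ψ σ θ' 0 :=
    funext fun θ' ↦ thetaFlux_eq_of_axisymmetric (hΨ.differentiable two_ne_zero) haxi σ θ' φ
  rw [hfun] at h1
  have heq : roundLap M Ψ σ θ φ = roundLap M Ψ σ θ 0 :=
    mul_left_cancel₀ hθ (h1.unique h0)
  rw [heq]

end Axisymmetric

/-! ### Continuity in the angles -/

/-- Continuity of `Δ̸Ψ(σ, θ(t), φ(t))` along continuous angle maps, for `Ψ` of class `C²` (all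
ingredients are polynomials in `sin, cos` of the angles and the continuous `2`-jet of `Ψ`).
[folklore] -/
theorem continuous_roundLap_comp {X : Type*} [TopologicalSpace X] {M : ℝ} {Ψ : E4 → ℝ}
    (hΨ : ContDiff ℝ 2 Ψ) (σ : ℝ) {θf φf : X → ℝ} (hθf : Continuous θf) (hφf : Continuous φf) :
    Continuous fun t : X ↦ roundLap M Ψ σ (θf t) (φf t) := by
  have hP : Continuous fun t : X ↦ horizonPoint M σ (θf t) (φf t) := by
    simp only [horizonPoint_eq_toLp]; refine continuous_toLp_four ?_ ?_ ?_ ?_ <;> fun_prop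
  have hL : Continuous fun t : X ↦ fderiv ℝ Ψ (horizonPoint M σ (θf t) (φf t)) :=
    (hΨ.continuous_fderiv two_ne_zero).comp hP
  have hB : Continuous fun t : X ↦ fderiv ℝ (fderiv ℝ Ψ) (horizonPoint M σ (θf t) (φf t)) :=
    ((hΨ.fderiv_right (m := 1) le_rfl).continuous_fderiv one_ne_zero).comp hP
  have hΘ : Continuous fun t : X ↦ thetaVec M (θf t) (φf t) := by
    simp only [thetaVec]; refine continuous_toLp_four ?_ ?_ ?_ ?_ <;> fun_prop
  have hdΘ : Continuous fun t : X ↦ dThetaVec M (θf t) (φf t) := by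
    simp only [dThetaVec]; refine continuous_toLp_four ?_ ?_ ?_ ?_ <;> fun_prop
  have hΦ : Continuous fun t : X ↦ phiHatVec M (φf t) := by
    simp only [phiHatVec]; refine continuous_toLp_four ?_ ?_ ?_ ?_ <;> fun_prop
  have hdΦ : Continuous fun t : X ↦ dPhiHatVec M (φf t) := by
    simp only [dPhiHatVec]; refine continuous_toLp_four ?_ ?_ ?_ ?_ <;> fun_prop
  have hsin : Continuous fun t : X ↦ Real.sin (θf t) := by fun_prop
  have hcos : Continuous fun t : X ↦ M * Real.cos (θf t) := by fun_prop
  simp only [roundLap]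
  exact ((((hB.clm_apply hΘ).clm_apply hΘ).add (hL.clm_apply hdΘ)).add
    (((hB.clm_apply hΦ).clm_apply hΦ).add (hsin.mul (hL.clm_apply hdΦ)))).sub
    (hcos.mul (hL.clm_apply continuous_const))

/-- Joint continuity of `(θ, φ) ↦ Δ̸Ψ(σ, θ, φ)` for `Ψ` of class `C²`. [folklore] -/
theorem continuous_roundLap_angles {M : ℝ} {Ψ : E4 → ℝ} (hΨ : ContDiff ℝ 2 Ψ) (σ : ℝ) :
    Continuous fun q : ℝ × ℝ ↦ roundLap M Ψ σ q.1 q.2 :=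
  continuous_roundLap_comp hΨ σ continuous_fst continuous_snd

/-- Joint continuity of `(θ, φ) ↦ Ψ(p_σ(θ, φ))` for continuous `Ψ`. [folklore] -/
theorem continuous_comp_horizonPoint_angles {M : ℝ} {Ψ : E4 → ℝ} (hΨ : Continuous Ψ) (σ : ℝ) :
    Continuous fun q : ℝ × ℝ ↦ Ψ (horizonPoint M σ q.1 q.2) :=
  hΨ.comp (continuous_horizonPoint_angles M σ)

/-! ### Pointwise control on the horizon spheres by sphere integrals (Lemma 15.0.1, axisymmetric
case) -/

/-- **Aretakis 2012, Lemma 15.0.1 (first display), axisymmetric case, on the horizon spheres.**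
For an axisymmetric `Ψ : E4 → ℝ` of class `C²` and every point `p_σ(θ, φ)` (`θ ∈ [0, π]`) of the
horizon sphere `S_σ`:
`Ψ(p_σ(θ, φ))² ≤ (2π)⁻¹ (∫₀^{2π}∫₀^π sin θ' Ψ(p_σ(θ', φ'))² dθ' dφ' + 2π² ∫₀^{2π}∫₀^π sin θ' (Δ̸Ψ)(σ, θ', φ')² dθ' dφ')`,
i.e. `‖ψ‖²_{L^∞(S_σ)} ≤ C (‖ψ‖²_{L²} + ‖Δ̸ψ‖²_{L²})` with the sphere integrals written in the
coordinates `(θ, φ*)` (measure `sin θ dθ dφ`) and `C = π` explicit. Printed: "we have the Sobolev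
inequality `‖ψ‖²_{L^∞(𝕊²)} ≤ C (‖ψ‖²_{L²(𝕊²)} + ‖Δ̸ψ‖²_{L²(𝕊²)})`" (proof of Lemma 15.0.1), applied on
the spheres of `Σ_τ ∩ {r ≥ M}`, of which `S_τ = Σ_τ ∩ 𝓗⁺` is the innermost. Proof: the profile
`f(θ') = Ψ(p_σ(θ', φ))` satisfies `(sin θ' f')' = sin θ' · Δ̸Ψ` on `(0, π)`
(`hasDerivAt_thetaFlux_of_axisymmetric`), so `sq_le_integral_sin_of_hasDerivAt` applies, and both
integrands are independent of `φ'` by axisymmetry. [cite: Aretakis2012, Lemma 15.0.1 (proof, first display)] -/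
theorem sq_le_sphereIntegrals_of_axisymmetric {M : ℝ} {Ψ : E4 → ℝ} (hΨ : ContDiff ℝ 2 Ψ)
    (haxi : ∀ β x, Ψ (E4.axialRotation β x) = Ψ x) (σ : ℝ) {θ : ℝ} (hθ : θ ∈ Icc 0 Real.pi)
    (φ : ℝ) :
    Ψ (horizonPoint M σ θ φ) ^ 2 ≤ (2 * Real.pi)⁻¹ *
      ((∫ φ' in (0 : ℝ)..2 * Real.pi, ∫ θ' in (0 : ℝ)..Real.pi,
          Real.sin θ' * Ψ (horizonPoint M σ θ' φ') ^ 2) +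
        2 * Real.pi ^ 2 * ∫ φ' in (0 : ℝ)..2 * Real.pi, ∫ θ' in (0 : ℝ)..Real.pi,
          Real.sin θ' * roundLap M Ψ σ θ' φ' ^ 2) := by
  have hπ := Real.pi_pos
  have hΨd : Differentiable ℝ Ψ := hΨ.differentiable two_ne_zero
  -- the profile along the meridian through `φ` and the one-dimensional inequality
  have hf : ∀ θ' ∈ Icc 0 Real.pi, HasDerivAt (fun x ↦ Ψ (horizonPoint M σ x φ))
      (fderiv ℝ Ψ (horizonPoint M σ θ' φ) (thetaVec M θ' φ)) θ' :=
    fun θ' _ ↦ hasDerivAt_comp_horizonPoint_theta (hΨd _)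
  have hPθ : Continuous fun x : ℝ ↦ horizonPoint M σ x φ := by
    simp only [horizonPoint_eq_toLp]; refine continuous_toLp_four ?_ ?_ ?_ ?_ <;> fun_prop
  have hΘ : Continuous fun x : ℝ ↦ thetaVec M x φ := by
    simp only [thetaVec]; refine continuous_toLp_four ?_ ?_ ?_ ?_ <;> fun_prop
  have hf' : ContinuousOn (fun θ' ↦ fderiv ℝ Ψ (horizonPoint M σ θ' φ) (thetaVec M θ' φ))
      (Icc 0 Real.pi) :=
    (((hΨ.continuous_fderiv two_ne_zero).comp hPθ).clm_apply hΘ).continuousOn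
  have hg0 : ∀ θ' ∈ Ioo 0 Real.pi, HasDerivAt (fun x ↦ thetaFlux M Ψ σ x φ)
      (Real.sin θ' * roundLap M Ψ σ θ' φ) θ' := fun θ' hθ' ↦
    hasDerivAt_thetaFlux_of_axisymmetric hΨ haxi σ (Real.sin_pos_of_pos_of_lt_pi hθ'.1 hθ'.2).ne' φ
  have hg : ∀ θ' ∈ Ioo 0 Real.pi, HasDerivAt
      (fun x ↦ Real.sin x * fderiv ℝ Ψ (horizonPoint M σ x φ) (thetaVec M x φ))
      (Real.sin θ' * roundLap M Ψ σ θ' φ) θ' := fun θ' hθ' ↦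
    (hg0 θ' hθ').congr_of_eventuallyEq (Eventually.of_forall fun x ↦ rfl)
  have hL : ContinuousOn (fun θ' ↦ roundLap M Ψ σ θ' φ) (Icc 0 Real.pi) :=
    (continuous_roundLap_comp hΨ σ continuous_id continuous_const).continuousOn
  have h1 := sq_le_integral_sin_of_hasDerivAt hf hf' hg hL hθ
  -- both sphere integrands are independent of `φ'`
  have hI0 : (∫ φ' in (0 : ℝ)..2 * Real.pi, ∫ θ' in (0 : ℝ)..Real.pi,
      Real.sin θ' * Ψ (horizonPoint M σ θ' φ') ^ 2) =
      2 * Real.pi * ∫ θ' in (0 : ℝ)..Real.pi, Real.sin θ' * Ψ (horizonPoint M σ θ' φ) ^ 2 := by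
    have h : ∀ φ', (∫ θ' in (0 : ℝ)..Real.pi, Real.sin θ' * Ψ (horizonPoint M σ θ' φ') ^ 2) =
        ∫ θ' in (0 : ℝ)..Real.pi, Real.sin θ' * Ψ (horizonPoint M σ θ' φ) ^ 2 := by
      intro φ'
      refine intervalIntegral.integral_congr fun θ' _ ↦ ?_
      simp only [apply_horizonPoint_eq_of_axisymmetric haxi σ θ' φ',
        apply_horizonPoint_eq_of_axisymmetric haxi σ θ' φ]
    simp only [h, intervalIntegral.integral_const, smul_eq_mul, sub_zero]
  have hI2 : (∫ φ' in (0 : ℝ)..2 * Real.pi, ∫ θ' in (0 : ℝ)..Real.pi,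
      Real.sin θ' * roundLap M Ψ σ θ' φ' ^ 2) =
      2 * Real.pi * ∫ θ' in (0 : ℝ)..Real.pi, Real.sin θ' * roundLap M Ψ σ θ' φ ^ 2 := by
    have h : ∀ φ', (∫ θ' in (0 : ℝ)..Real.pi, Real.sin θ' * roundLap M Ψ σ θ' φ' ^ 2) =
        ∫ θ' in (0 : ℝ)..Real.pi, Real.sin θ' * roundLap M Ψ σ θ' φ ^ 2 := by
      intro φ'
      refine intervalIntegral.integral_congr fun θ' _ ↦ ?_
      simp only [sin_mul_roundLap_sq_eq_of_axisymmetric hΨ haxi σ θ' φ',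
        sin_mul_roundLap_sq_eq_of_axisymmetric hΨ haxi σ θ' φ]
    simp only [h, intervalIntegral.integral_const, smul_eq_mul, sub_zero]
  rw [hI0, hI2]
  have h2 : (2 * Real.pi)⁻¹ * (2 * Real.pi * (∫ θ' in (0 : ℝ)..Real.pi,
      Real.sin θ' * Ψ (horizonPoint M σ θ' φ) ^ 2) + 2 * Real.pi ^ 2 *
        (2 * Real.pi * ∫ θ' in (0 : ℝ)..Real.pi, Real.sin θ' * roundLap M Ψ σ θ' φ ^ 2)) =
      (∫ θ' in (0 : ℝ)..Real.pi, Real.sin θ' * Ψ (horizonPoint M σ θ' φ) ^ 2) +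
        2 * Real.pi ^ 2 * ∫ θ' in (0 : ℝ)..Real.pi, Real.sin θ' * roundLap M Ψ σ θ' φ ^ 2 := by
    field_simp
  rw [h2]
  exact h1

/-- **Decay on the horizon spheres, pointwise from square-integrated.** For an axisymmetric `C²`
function `Ψ` on `E4`: if the sphere integrals `∫∫ sin θ Ψ(p_σ)²` and `∫∫ sin θ (Δ̸Ψ)(σ)²` tend to `0` as
`σ → ∞`, then `sup_{S_σ} |Ψ| → 0` (at all points `p_σ(θ, φ)`, `θ ∈ [0, π]`). This is the passage from
the `L²(S²)` estimates of §15.2 to Theorem 5 in Aretakis, JFA 263 (2012), §15 (Lemma 15.0.1 with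
`𝕊₂ ∋ Q`, the Carter operator supplying `Δ̸ψ`), in qualitative form.
[cite: Aretakis2012, §15 (Lemma 15.0.1 and §15.2.2)] -/
theorem horizon_decay_of_sphereDecay {M : ℝ} {Ψ : E4 → ℝ} (hΨ : ContDiff ℝ 2 Ψ)
    (haxi : ∀ β x, Ψ (E4.axialRotation β x) = Ψ x)
    (h0 : ∀ ε : ℝ, 0 < ε → ∃ τ₁ : ℝ, ∀ σ : ℝ, τ₁ ≤ σ →
      (∫ φ in (0 : ℝ)..2 * Real.pi, ∫ θ in (0 : ℝ)..Real.pi,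
        Real.sin θ * Ψ (horizonPoint M σ θ φ) ^ 2) ≤ ε)
    (h2 : ∀ ε : ℝ, 0 < ε → ∃ τ₁ : ℝ, ∀ σ : ℝ, τ₁ ≤ σ →
      (∫ φ in (0 : ℝ)..2 * Real.pi, ∫ θ in (0 : ℝ)..Real.pi,
        Real.sin θ * roundLap M Ψ σ θ φ ^ 2) ≤ ε) :
    ∀ ε : ℝ, 0 < ε → ∃ τ₁ : ℝ, ∀ σ : ℝ, τ₁ ≤ σ →
      ∀ θ ∈ Icc 0 Real.pi, ∀ φ : ℝ, |Ψ (horizonPoint M σ θ φ)| ≤ ε := by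
  intro ε hε
  have hπ := Real.pi_pos
  obtain ⟨τa, hτa⟩ := h0 (Real.pi * ε ^ 2) (by positivity)
  obtain ⟨τb, hτb⟩ := h2 (ε ^ 2 / (2 * Real.pi)) (by positivity)
  refine ⟨max τa τb, fun σ hσ θ hθ φ ↦ ?_⟩
  have ha := hτa σ ((le_max_left _ _).trans hσ)
  have hb := hτb σ ((le_max_right _ _).trans hσ)
  have h := sq_le_sphereIntegrals_of_axisymmetric (M := M) hΨ haxi σ hθ φ
  have hsq : Ψ (horizonPoint M σ θ φ) ^ 2 ≤ ε ^ 2 := by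
    have h3 : (2 * Real.pi)⁻¹ * ((∫ φ' in (0 : ℝ)..2 * Real.pi, ∫ θ' in (0 : ℝ)..Real.pi,
        Real.sin θ' * Ψ (horizonPoint M σ θ' φ') ^ 2) +
        2 * Real.pi ^ 2 * ∫ φ' in (0 : ℝ)..2 * Real.pi, ∫ θ' in (0 : ℝ)..Real.pi,
          Real.sin θ' * roundLap M Ψ σ θ' φ' ^ 2) ≤
        (2 * Real.pi)⁻¹ * (Real.pi * ε ^ 2 + 2 * Real.pi ^ 2 * (ε ^ 2 / (2 * Real.pi))) := by
      refine mul_le_mul_of_nonneg_left ?_ (by positivity)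
      exact add_le_add ha (mul_le_mul_of_nonneg_left hb (by positivity))
    have h4 : (2 * Real.pi)⁻¹ * (Real.pi * ε ^ 2 + 2 * Real.pi ^ 2 * (ε ^ 2 / (2 * Real.pi))) =
        ε ^ 2 := by
      field_simp
      ring
    linarith [h, h3, h4.le, h4.ge]
  calc |Ψ (horizonPoint M σ θ φ)| = Real.sqrt (Ψ (horizonPoint M σ θ φ) ^ 2) :=
      (Real.sqrt_sq_eq_abs _).symm
    _ ≤ Real.sqrt (ε ^ 2) := Real.sqrt_le_sqrt hsq
    _ = ε := Real.sqrt_sq hε.le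

/-! ### Every point of a horizon sphere has angular coordinates -/

/-- **The angular coordinates cover the horizon spheres**: every point of
`S_τ = {r = M} ∩ {t* = τ}` is `p_τ(θ, φ)` for some `θ ∈ [0, π]` and `φ` (off the axis by
`Kerr.exists_kerrStar_eq`; the two axis points are the poles `θ = 0, π`). [folklore] -/
theorem exists_horizonPoint_eq {M r₀ τ : ℝ} (hM : 0 < M) {x : Kerr.region M r₀}
    (hx : x ∈ horizonSection M M r₀ τ) :
    ∃ θ ∈ Icc 0 Real.pi, ∃ φ : ℝ, (x : E4) = horizonPoint M τ θ φ := by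
  rw [mem_horizonSection, rPlus_self] at hx
  obtain ⟨hr, h0⟩ := hx
  set y : E3 := E4.spatial (x : E4) with hydef
  have hxy : (x : E4) = E4.ofTimeSpace τ y := by
    rw [← h0]
    exact (E4.ofTimeSpace_time_spatial _).symm
  have hry : Kerr.radius M (E4.ofTimeSpace 0 y) = M := by
    rw [Kerr.radius_ofTimeSpace_spatial]; exact hr
  by_cases hax : y 0 ≠ 0 ∨ y 1 ≠ 0
  · obtain ⟨θ, hθ, φ, hk⟩ := Kerr.exists_kerrStar_eq (a := M) (y := y) (by rw [hry]; exact hM) hax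
    rw [hry] at hk
    refine ⟨θ, Ioo_subset_Icc_self hθ, φ, ?_⟩
    rw [hxy, ← hk, ← shellPoint_self]
    rfl
  · push Not at hax
    obtain ⟨hy0, hy1⟩ := hax
    have hq := Kerr.radius_slice_quartic M y
    rw [hry, E3.norm_sq, hy0, hy1] at hq
    have h2 : M ^ 2 * (y 2 - M) * (y 2 + M) = 0 := by linear_combination (-1 / 2 : ℝ) * hq
    have hM2 : M ^ 2 ≠ 0 := by positivity
    rcases mul_eq_zero.mp h2 with h | h
    · rcases mul_eq_zero.mp h with h | h
      · exact absurd h hM2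
      · -- `y 2 = M`: the north pole `θ = 0`
        refine ⟨0, ⟨le_rfl, Real.pi_pos.le⟩, 0, ?_⟩
        rw [hxy, horizonPoint_eq_toLp]
        ext i
        fin_cases i
        · simp
        · show (E4.ofTimeSpace τ y) (Fin.succ 0) = _
          rw [E4.ofTimeSpace_apply_succ, hy0]; simp
        · show (E4.ofTimeSpace τ y) (Fin.succ 1) = _
          rw [E4.ofTimeSpace_apply_succ, hy1]; simp
        · show (E4.ofTimeSpace τ y) (Fin.succ 2) = _
          rw [E4.ofTimeSpace_apply_succ]; simp; linarith
    · -- `y 2 = -M`: the south pole `θ = π`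
      refine ⟨Real.pi, ⟨Real.pi_pos.le, le_rfl⟩, 0, ?_⟩
      rw [hxy, horizonPoint_eq_toLp]
      ext i
      fin_cases i
      · simp
      · show (E4.ofTimeSpace τ y) (Fin.succ 0) = _
        rw [E4.ofTimeSpace_apply_succ, hy0]; simp
      · show (E4.ofTimeSpace τ y) (Fin.succ 1) = _
        rw [E4.ofTimeSpace_apply_succ, hy1]; simp
      · show (E4.ofTimeSpace τ y) (Fin.succ 2) = _
        rw [E4.ofTimeSpace_apply_succ]; simp; linarith

end Literature.Barriers.FinalStateConjecture.Kerr

namespace Literature.Barriers.FinalStateConjecture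

open Literature.Geometry.Lorentzian

/-! ### Reduction of the named fact to the decay of two sphere integrals -/

/-- **`Aretakis2012_pointwiseDecay` from `L²(S_τ)` decay of `ψ` and of `Δ̸ψ` (Aretakis 2012, §15:
Thm. 5 from §15.2.2 through Lemma 15.0.1).** Suppose that for every globally represented member of the
class of the fact — `Φ : E4 → ℝ` smooth and axisymmetric, solving `□_{g_{M,M}} Φ = 0` on an open
`U₀ ⊇ {r ≥ M} ∩ {t* ≥ 0}` of the chart `Kerr.region M r₀` (`0 < r₀ < M`), with Cauchy data on
`{t* = 0}` supported in a coordinate ball (the hypotheses of `Kerr.decay_at_horizonPoint`) — the two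
sphere integrals `∫₀^{2π}∫₀^π sin θ Φ(p_τ(θ, φ))² dθ dφ` and `∫₀^{2π}∫₀^π sin θ (Δ̸Φ)(τ, θ, φ)² dθ dφ`
(`Kerr.roundLap`) tend to `0` as `τ → ∞`. Then `Aretakis2012_pointwiseDecay` holds. In the printed proof
the first hypothesis is the conclusion of §15.2.2 (`∫_{𝕊²} ψ² ≤ C E₁ τ⁻¹` on the spheres of
`𝓐 ∪ 𝓗⁺`; in this library `Kerr.horizonSphereSq_decay_of_shellEnergy` derives its qualitative form from
the energy statements (A), (B), (F)), and the second follows from the first applied to the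
axisymmetric solutions `Qψ`, `T²ψ` through `Δ̸ψ = Qψ − M² sin² θ · TTψ` on `S_τ` (`Q` the Carter
operator, §5.3 and Lemma 15.0.1: `|Δ̸ψ|² ≤ C(|Qψ|² + |TTψ|² + |ΦΦψ|²)`). Proof: a general `ψ` of the
class is replaced by the smooth axisymmetric global representative `ψ₀ = ∫₀^{2π} (χψ) ∘ R_α dα = 2πψ`
near `{r ≥ M} ∩ {t* ≥ 0}` (`Kerr.rotAverage`, as in `Aretakis2015.axisymmetricBlowup_of_decay`), to
which `Kerr.horizon_decay_of_sphereDecay` applies; every point of `S_τ` has angular coordinates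
(`Kerr.exists_horizonPoint_eq`). [cite: Aretakis2012, Thm. 5 (second clause), Lemma 15.0.1 and §15.2.2] -/
theorem Aretakis2012_pointwiseDecay_of_sphereDecay
    (H : ∀ [Kerr.Facts] [Kerr.SliceFacts] (M : ℝ), 0 < M → ∀ r₀ ∈ Set.Ioo 0 M,
      ∀ (U₀ : Set (Kerr.region M r₀)) (Φ : E4 → ℝ), IsOpen U₀ →
        {x : Kerr.region M r₀ | Kerr.rPlus M M ≤ Kerr.radius M (x : E4) ∧ 0 ≤ (x : E4) 0} ⊆ U₀ →
        ContDiff ℝ ∞ Φ →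
        (∀ x ∈ U₀, (Kerr.smoothMetric M M r₀).toPseudoRiemannianMetric.dalembertian
          (fun y : Kerr.region M r₀ ↦ Φ y) x = 0) →
        (∃ ρ : ℝ, ∀ x ∈ U₀, (x : E4) 0 = 0 → ρ < E4.spatialNorm (x : E4) →
          Φ x = 0 ∧ fderiv ℝ Φ x = 0) →
        (∀ β x, Φ (E4.axialRotation β x) = Φ x) →
        (∀ ε : ℝ, 0 < ε → ∃ τ₁ : ℝ, ∀ τ : ℝ, τ₁ ≤ τ →
          (∫ φ in (0 : ℝ)..2 * Real.pi, ∫ θ in (0 : ℝ)..Real.pi,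
            Real.sin θ * Φ (Kerr.horizonPoint M τ θ φ) ^ 2) ≤ ε) ∧
        (∀ ε : ℝ, 0 < ε → ∃ τ₁ : ℝ, ∀ τ : ℝ, τ₁ ≤ τ →
          (∫ φ in (0 : ℝ)..2 * Real.pi, ∫ θ in (0 : ℝ)..Real.pi,
            Real.sin θ * Kerr.roundLap M Φ τ θ φ ^ 2) ≤ ε)) :
    Aretakis2012_pointwiseDecay := by
  intro _ _ M hM r₀ hr₀ U ψ hU hKU hψ hsol hloc haxiψ ε hε
  obtain ⟨hr₀pos, hr₀M⟩ := hr₀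
  obtain ⟨ρ, hρ⟩ := hloc
  have hπ := Real.pi_pos
  /- Step 1: the representative, the open set over `U`, the cutoff (as in
  `Aretakis2015.axisymmetricBlowup_of_decay`) -/
  set Ψ : E4 → ℝ := Function.extend Subtype.val ψ 0 with hΨdef
  have hrep : ∀ y : Kerr.region M r₀, ψ y = Ψ y := Kerr.extend_apply_coe ψ
  set V : Set E4 := Subtype.val '' U with hVdef
  have hV : IsOpen V := (Kerr.region M r₀).isOpen.isOpenMap_subtype_val U hU
  have hΨV : ∀ x ∈ V, ContDiffAt ℝ ∞ Ψ x := by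
    rintro x ⟨y, hyU, rfl⟩
    exact (OpensChart.contMDiffAt_iff y ψ Ψ hrep).mp (hψ.contMDiffAt (hU.mem_nhds hyU))
  set K' : Set E4 := {x : E4 | Kerr.rPlus M M ≤ Kerr.radius M x ∧ 0 ≤ x 0} with hK'def
  have hK'c : IsClosed K' := Kerr.isClosed_horizonFutureSet M M
  have hK'reg : ∀ x ∈ K', x ∈ Kerr.region M r₀ := by
    intro x hx
    rw [Kerr.mem_region]
    have h1 : Kerr.rPlus M M ≤ Kerr.radius M x := hx.1
    rw [Kerr.rPlus_self] at h1
    exact max_lt (by linarith) (by linarith)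
  have hK'V : K' ⊆ V := fun x hx ↦ ⟨⟨x, hK'reg x hx⟩, hKU hx, rfl⟩
  obtain ⟨χ, N, hχ, hN, hKN, hNV, hχ1, hχsupp⟩ := Kerr.exists_smooth_cutoff hK'c hV hK'V
  set G : E4 → ℝ := fun z ↦ χ z * Ψ z with hGdef
  have hG : ContDiff ℝ ∞ G := Kerr.contDiff_cutoff_mul hχ hχsupp hΨV
  have hGN : EqOn G Ψ N := fun z hz ↦ by
    show χ z * Ψ z = Ψ z
    rw [hχ1 z hz, one_mul]
  have hNU : ∀ z ∈ N, ∃ hz : z ∈ Kerr.region M r₀, (⟨z, hz⟩ : Kerr.region M r₀) ∈ U := by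
    intro z hz
    obtain ⟨y, hyU, hyz⟩ := hNV hz
    subst hyz
    exact ⟨y.2, hyU⟩
  -- the rotation-invariant open set `U₀ ⊆ U` containing `K`
  set U₀ : Set (Kerr.region M r₀) := {x | ∀ α : ℝ, E4.axialRotation α x ∈ N} with hU₀def
  have hU₀ : IsOpen U₀ :=
    (Kerr.isOpen_setOf_forall_axialRotation_mem hN).preimage continuous_subtype_val
  have hKU₀ : {x : Kerr.region M r₀ | Kerr.rPlus M M ≤ Kerr.radius M (x : E4) ∧ 0 ≤ (x : E4) 0} ⊆
      U₀ := by
    intro x hx α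
    exact hKN (Kerr.axialRotation_mem_horizonFutureSet_iff.mpr hx)
  have hU₀N : ∀ x ∈ U₀, ∀ α, E4.axialRotation α (x : E4) ∈ N := fun x hx ↦ hx
  /- Step 2: the averaged solution `ψ₀` -/
  set Ψ₀ : E4 → ℝ := Kerr.rotAverage G with hΨ₀def
  have hΨ₀ : ContDiff ℝ ∞ Ψ₀ := Kerr.contDiff_rotAverage hG
  have hsol₀ : ∀ x ∈ U₀, (Kerr.smoothMetric M M r₀).toPseudoRiemannianMetric.dalembertian
      (fun y : Kerr.region M r₀ ↦ Ψ₀ y) x = 0 :=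
    fun x hx ↦ Kerr.dalembertian_rotAverage_eq_zero hU hψ hsol hG hN hNU hGN x (hU₀N x hx)
  have hloc₀ : ∃ ρ' : ℝ, ∀ x ∈ U₀, (x : E4) 0 = 0 → ρ' < E4.spatialNorm (x : E4) →
      Ψ₀ x = 0 ∧ fderiv ℝ Ψ₀ x = 0 := by
    refine ⟨ρ, fun x hx hx0 hxρ ↦ ?_⟩
    have hzero : ∀ α, Ψ (E4.axialRotation α x) = 0 ∧
        fderiv ℝ Ψ (E4.axialRotation α x) = 0 := by
      intro α
      obtain ⟨hz, hzU⟩ := hNU _ (hU₀N x hx α)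
      have h := hρ ⟨_, hz⟩ hzU (by simp [hx0]) (by simpa [E4.spatialNorm_axialRotation] using hxρ)
      have hd : DifferentiableAt ℝ Ψ (E4.axialRotation α x) :=
        ((OpensChart.contMDiffAt_iff ⟨_, hz⟩ ψ Ψ hrep).mp
          (hψ.contMDiffAt (hU.mem_nhds hzU))).differentiableAt
          (WithTop.coe_ne_zero.mpr ENat.top_ne_zero)
      refine ⟨by rw [← hrep ⟨_, hz⟩]; exact h.1, ?_⟩
      rw [← OpensChart.mfderiv_eq ⟨_, hz⟩ ψ Ψ hrep hd]
      exact h.2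
    have hz1 : ∀ α, Ψ (E4.axialRotation α x) = 0 := fun α ↦ (hzero α).1
    have hz2 : ∀ α, fderiv ℝ Ψ (E4.axialRotation α x) = 0 := fun α ↦ (hzero α).2
    constructor
    · show Kerr.rotAverage G x = 0
      rw [Kerr.rotAverage_apply_of_forall_mem hGN (hU₀N x hx)]
      simp only [hz1, intervalIntegral.integral_zero]
    · ext v
      rw [Kerr.fderiv_rotAverage_apply_of_forall_mem hG hN hGN (hU₀N x hx)]
      simp only [hz2, _root_.zero_apply, intervalIntegral.integral_zero]
  have haxi₀ : ∀ β (x : E4), Ψ₀ (E4.axialRotation β x) = Ψ₀ x := fun β x ↦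
    Kerr.rotAverage_axialRotation G β x
  /- Step 3: the sphere decay of `ψ₀` (hypothesis) and its pointwise decay on the spheres -/
  obtain ⟨h0, h2⟩ := H M hM r₀ ⟨hr₀pos, hr₀M⟩ U₀ Ψ₀ hU₀ hKU₀ hΨ₀ hsol₀ hloc₀ haxi₀
  have hΨ₀2 : ContDiff ℝ 2 Ψ₀ := hΨ₀.of_le (WithTop.coe_le_coe.mpr le_top)
  obtain ⟨τ₁, hτ₁⟩ := Kerr.horizon_decay_of_sphereDecay hΨ₀2 haxi₀ h0 h2 (2 * Real.pi * ε)
    (by positivity)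
  refine ⟨max τ₁ 0, fun τ hτ x hxS ↦ ?_⟩
  have hτ0 : 0 ≤ τ := (le_max_right _ _).trans hτ
  obtain ⟨θ, hθ, φ, hxe⟩ := Kerr.exists_horizonPoint_eq hM hxS
  /- Step 4: `ψ₀ = 2π ψ` at the points of `S_τ ⊆ K` -/
  have hxK : (x : E4) ∈ K' := by
    rw [Kerr.mem_horizonSection] at hxS
    exact ⟨hxS.1.ge, by rw [hxS.2]; exact hτ0⟩
  have horb : ∀ α, E4.axialRotation α (x : E4) ∈ N := fun α ↦
    hKN (Kerr.axialRotation_mem_horizonFutureSet_iff.mpr hxK)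
  have hval : Ψ₀ x = 2 * Real.pi * ψ x := by
    show Kerr.rotAverage G x = _
    rw [Kerr.rotAverage_apply_of_forall_mem hGN horb]
    have h : ∀ α, Ψ (E4.axialRotation α x) = ψ x := fun α ↦ by
      rw [← Kerr.coe_axialRotate M r₀ α x, ← hrep, haxiψ α x]
    simp only [h, intervalIntegral.integral_const, smul_eq_mul, sub_zero]
  have hb := hτ₁ τ ((le_max_left _ _).trans hτ) θ hθ φ
  rw [← hxe, hval, abs_mul, abs_of_pos (by positivity : (0 : ℝ) < 2 * Real.pi)] at hb
  exact le_of_mul_le_mul_left hb (by positivity)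

end Literature.Barriers.FinalStateConjecture

end
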